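import Summits.QuantumFields.YangMills.Theorems.UnitScaleTiltProp7CovAgmonLetters
import Summits.QuantumFields.YangMills.Theorems.UnitScaleTiltProp7CovInterpKernelDual
import HarnessLib

/-!
# Route `UnitScaleTilt`, crux K1 «MinimiserStabilityRegPr» (stmt-QuantumFields-19200), route-R E′ path (α′), S2 ∕ (E1-b) at the CURVED background — (D2′-cov) FILE 2:
# THE WEIGHTED INTERPOLATION INEQUALITY FOR THE COVARIANT GRADIENT, `Σ_xΣ_μ ω²hs(D_μe) ≤ 2·√(Σω²hs e)·√(Σω²hs Δ_Ue) + γ²·Σω²hs e` (`γ = (15∕4)a√d`), and the HS-`ℓ²`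
# pairing letters (Cauchy–Schwarz summed, Minkowski) that the covariant Agmon core (FILE 3) consumes — covariant twin of ✓ `Prop7PinnedBiharmonicAgmonInterp`

Cell `ym3-torus`, extra width seat `ym-routeR-w6` (gen 6); LOCATE `ym-routeR-w6/LOCATE-PCOV2-routeRw6g6.md` v1.1.  THEOREMS ONLY (0 `def`, 0 `sorry`); `--supports stmt-QuantumFields-19200`,
count-neutral.  YM₃ on T³ is a ladder rung (R3), not the Clay problem; nothing here claims a stub, the crux, d = 4 or the mass gap.

WHAT IS PROVED (ns `…Theorems.Prop7CovAgmonInterp`; torus `Site P i`, unitary `U`, `hs X = Σ‖X_jk‖²`, pairing `Re Tr(XᴴY)`).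
* §1 `sum_re_trace_le_sqrt_mul_sqrt` (`Σ_x⟨A_x,B_x⟩ ≤ √Σhs A·√Σhs B`), `abs_sum_re_trace_le_sqrt_mul_sqrt`, `re_trace_conjTranspose_mul_smul`, `re_trace_smul_smul`,
  `sqrt_sum_hs_add_le` (Minkowski for the HS-`ℓ²` norm of site families).
* §3 `abs_sum_re_trace_le_sqrt_mul_sqrt`, `hs_add_eq`, `sqrt_sum_hs_add_le` (Minkowski), ★ `sum_hs_sqweight_transport_le` (the squared-weight transport remainder `≤ γ²·Σω²hs e`).
* §2 ★★ `weighted_covGrad_sq_le` — Green's identity ✓ `sum_sum_covD_mul` with `v = ω²•e`, Leibniz with the weight at the source ✓ `covD_smul_fun_src`, ✓ `sq_weight_rows`,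
  `ω(x) ≤ (3∕2)ω(x+e_μ)`, Cauchy–Schwarz over `(x, μ)`.
HONEST SCOPE.  One inequality + letters; the Agmon core is FILE 3.

References: T. Bałaban, CMP 96 (1984) 223–250 [Balaban1984PropagatorsII] ((1.9) p.226); CMP 99 (1985) 389–434 [Balaban1985BackgroundPropagators] ((3.3), (3.8) pp.390–392).
-/

set_option autoImplicit false

noncomputable section

open scoped BigOperators Matrix.Norms.L2Operator Matrix

namespace Summit.QuantumFields.YangMills.Theorems.Prop7CovAgmonInterp

open Literature.MathematicalPhysics.QuantumFieldTheory.Balaban1983to89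
open B10StarCount (shift_unshift unshift_shift)
open B9Eq39Adjoint (R covD covDstar divB sum_sum_covD_mul)
open B9TorusCalculus (torusT torusT_apply torusT_symm_apply)
open Summit.QuantumFields.YangMills.Theorems.Prop7FlatCoercivity (sum_shift)
open Summit.QuantumFields.YangMills.Theorems.Prop7CovariantCoercivity (sum_norm_sq_R conjTranspose_covD re_trace_conjTranspose_mul_self re_trace_mul_comm)
open Summit.QuantumFields.YangMills.Theorems.Prop7PinnedBiharmonicAgmonLetters (weight_shift_le weight_unshift_le)
open Summit.QuantumFields.YangMills.Theorems.Prop7PinnedBiharmonicAgmonInterp (sq_weight_rows)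
open Summit.QuantumFields.YangMills.Theorems.Prop7CovInterpKernelDual (abs_re_trace_le_sqrt_mul_sqrt sum_re_trace_covLaplace_comm)
open Summit.QuantumFields.YangMills.Theorems.Prop7CovAgmonLetters (hs_smul covD_smul_fun_src)

variable {P : Params} {i : ℕ} {N : ℕ}

/-! ## §1–§2 Pairing letters and ★★ the weighted interpolation inequality for the covariant gradient -/

section Interp

variable {U : Fin P.d → Site P i → (Matrix (Fin N) (Fin N) ℂ)ˣ}

omit U in
/-- `Σ_x Re Tr(A_xᴴ B_x) ≤ √(Σ_x hs A_x)·√(Σ_x hs B_x)` (pointwise Cauchy–Schwarz + Cauchy–Schwarz in `x`). [folklore] -/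
theorem sum_re_trace_le_sqrt_mul_sqrt {ι : Type*} (s : Finset ι) (A B : ι → Matrix (Fin N) (Fin N) ℂ) :
    ∑ x ∈ s, (((A x)ᴴ * B x).trace).re
      ≤ Real.sqrt (∑ x ∈ s, ∑ j : Fin N, ∑ k : Fin N, ‖(A x) j k‖ ^ 2) * Real.sqrt (∑ x ∈ s, ∑ j : Fin N, ∑ k : Fin N, ‖(B x) j k‖ ^ 2) := by
  have h1 : ∑ x ∈ s, (((A x)ᴴ * B x).trace).re
      ≤ ∑ x ∈ s, Real.sqrt (∑ j : Fin N, ∑ k : Fin N, ‖(A x) j k‖ ^ 2) * Real.sqrt (∑ j : Fin N, ∑ k : Fin N, ‖(B x) j k‖ ^ 2) :=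
    Finset.sum_le_sum fun x _ => (le_abs_self _).trans (abs_re_trace_le_sqrt_mul_sqrt _ _)
  refine h1.trans ((Real.sum_mul_le_sqrt_mul_sqrt s _ _).trans (le_of_eq ?_))
  congr 1
  · congr 1; exact Finset.sum_congr rfl fun x _ => Real.sq_sqrt (Finset.sum_nonneg fun _ _ => Finset.sum_nonneg fun _ _ => sq_nonneg _)
  · congr 1; exact Finset.sum_congr rfl fun x _ => Real.sq_sqrt (Finset.sum_nonneg fun _ _ => Finset.sum_nonneg fun _ _ => sq_nonneg _)

omit U in
/-- `hs X = Re Tr(Xᴴ·X)` read with a real scalar: `Re Tr(Xᴴ·(r•Y)) = r·Re Tr(Xᴴ·Y)`. [folklore] -/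
theorem re_trace_conjTranspose_mul_smul (r : ℝ) (X Y : Matrix (Fin N) (Fin N) ℂ) :
    ((Xᴴ * (r • Y)).trace).re = r * ((Xᴴ * Y).trace).re := by
  rw [Matrix.mul_smul, Matrix.trace_smul, Complex.real_smul, Complex.re_ofReal_mul]

omit U in
/-- `Re Tr((r•X)ᴴ·(s•Y)) = (r·s)·Re Tr(Xᴴ·Y)` for real scalars. [folklore] -/
theorem re_trace_smul_smul (r s' : ℝ) (X Y : Matrix (Fin N) (Fin N) ℂ) :
    (((r • X)ᴴ * (s' • Y)).trace).re = r * s' * ((Xᴴ * Y).trace).re := by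
  rw [Matrix.conjTranspose_smul, star_trivial, Matrix.smul_mul, Matrix.mul_smul, smul_smul, Matrix.trace_smul, Complex.real_smul,
    Complex.re_ofReal_mul]

/-- ★★ **WEIGHTED INTERPOLATION FOR THE COVARIANT GRADIENT** (unitary background, weight rows `a ≤ 1∕2`, any field `e`): with
`G² := Σ_xΣ_μ ω(x)²hs(D_μe(x))`, `N := √Σ_x ω²hs(e)`, `E := √Σ_x ω²hs(Δ_Ue)`, `γ := (15∕4)a√d`:  `G² ≤ 2·N·E + γ²·N²`.
(Green: `Σ⟨D e, D(ω²e)⟩ = Σ⟨Δ_Ue, ω²e⟩ ≤ EN`; Leibniz with the weight at the source; `ω⁻¹|ω(x+e_μ)² − ω(x)²| ≤ (5∕2)aω`, `ω(x) ≤ (3∕2)ω(x+e_μ)`.)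
[cite: Balaban1984PropagatorsII, (1.9) p.226; Balaban1985BackgroundPropagators, (3.8) p.392] -/
theorem weighted_covGrad_sq_le (hU : ∀ ν x, (U ν x : Matrix (Fin N) (Fin N) ℂ) ∈ unitary (Matrix (Fin N) (Fin N) ℂ))
    (ω : Site P i → ℝ) (e : Site P i → Matrix (Fin N) (Fin N) ℂ) {a b : ℝ} (ha0 : 0 ≤ a) (ha : a ≤ 1 / 2) (hω₀ : ∀ x, 0 < ω x)
    (hω₁ : ∀ x μ, |ω (x.shift μ) - ω x| ≤ a * ω x ∧ |ω (x.unshift μ) - ω x| ≤ a * ω x)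
    (hω₂ : ∀ x μ, |ω (x.shift μ) + ω (x.unshift μ) - 2 * ω x| ≤ b * ω x) :
    ∑ x : Site P i, ∑ μ : Fin P.d, ω x ^ 2 * ∑ j : Fin N, ∑ k : Fin N, ‖(covD (torusT P i) U μ e x) j k‖ ^ 2
      ≤ 2 * Real.sqrt (∑ x : Site P i, ω x ^ 2 * ∑ j : Fin N, ∑ k : Fin N, ‖(e x) j k‖ ^ 2)
            * Real.sqrt (∑ x : Site P i, ω x ^ 2 * ∑ j : Fin N, ∑ k : Fin N, ‖(divB (torusT P i) U (fun μ => covD (torusT P i) U μ e) x) j k‖ ^ 2)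
        + (15 / 4 * a * Real.sqrt P.d) ^ 2 * ∑ x : Site P i, ω x ^ 2 * ∑ j : Fin N, ∑ k : Fin N, ‖(e x) j k‖ ^ 2 := by
  classical
  have hd : (0 : ℝ) ≤ P.d := Nat.cast_nonneg _
  set τ := Complex.reAddGroupHom.comp (Matrix.traceAddMonoidHom (Fin N) ℂ) with hτ
  have hτa : ∀ A : Matrix (Fin N) (Fin N) ℂ, τ A = (A.trace).re := fun A => by simp [hτ]
  set G2 := ∑ x : Site P i, ∑ μ : Fin P.d, ω x ^ 2 * ∑ j : Fin N, ∑ k : Fin N, ‖(covD (torusT P i) U μ e x) j k‖ ^ 2 with hG2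
  set N2 := ∑ x : Site P i, ω x ^ 2 * ∑ j : Fin N, ∑ k : Fin N, ‖(e x) j k‖ ^ 2 with hN2
  set E2 := ∑ x : Site P i, ω x ^ 2 * ∑ j : Fin N, ∑ k : Fin N, ‖(divB (torusT P i) U (fun μ => covD (torusT P i) U μ e) x) j k‖ ^ 2 with hE2
  have hG0 : 0 ≤ G2 := Finset.sum_nonneg fun _ _ => Finset.sum_nonneg fun _ _ => by positivity
  have hN0 : 0 ≤ N2 := Finset.sum_nonneg fun _ _ => by positivity
  have hE0 : 0 ≤ E2 := Finset.sum_nonneg fun _ _ => by positivity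
  -- weighted fields
  set v : Site P i → Matrix (Fin N) (Fin N) ℂ := fun z => (ω z ^ 2) • e z with hv
  -- STEP 1: `G2 = Σ⟨D e, D v⟩ − Σ⟨D e, (ω₊² − ω²)•R(U)e₊⟩`
  have hLeib : ∀ x μ, covD (torusT P i) U μ v x = (ω x ^ 2) • covD (torusT P i) U μ e x
      + (ω (torusT P i μ x) ^ 2 - ω x ^ 2) • R (U μ x) (e (torusT P i μ x)) := fun x μ => covD_smul_fun_src U (fun z => ω z ^ 2) e μ x
  have hstep1 : G2 = ∑ x : Site P i, ∑ μ : Fin P.d, (((covD (torusT P i) U μ e x)ᴴ * covD (torusT P i) U μ v x).trace).re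
      - ∑ x : Site P i, ∑ μ : Fin P.d, (((covD (torusT P i) U μ e x)ᴴ
          * ((ω (torusT P i μ x) ^ 2 - ω x ^ 2) • R (U μ x) (e (torusT P i μ x)))).trace).re := by
    rw [← Finset.sum_sub_distrib, hG2]
    refine Finset.sum_congr rfl fun x _ => ?_
    rw [← Finset.sum_sub_distrib]
    refine Finset.sum_congr rfl fun μ _ => ?_
    rw [hLeib, mul_add, Matrix.trace_add, Complex.add_re, add_sub_cancel_right, re_trace_conjTranspose_mul_smul, re_trace_conjTranspose_mul_self]
  -- STEP 2: Green: `Σ⟨D e, D v⟩ = Σ⟨Δ_Ue, v⟩ ≤ E·N`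
  have hgreen : ∑ x : Site P i, ∑ μ : Fin P.d, (((covD (torusT P i) U μ e x)ᴴ * covD (torusT P i) U μ v x).trace).re
      = ∑ x : Site P i, (((divB (torusT P i) U (fun μ => covD (torusT P i) U μ e) x)ᴴ * v x).trace).re := by
    have h := sum_sum_covD_mul (torusT P i) U τ re_trace_mul_comm (fun z => (e z)ᴴ) (fun μ => covD (torusT P i) U μ v)
    have hl : ∑ x : Site P i, ∑ μ : Fin P.d, τ (covD (torusT P i) U μ (fun z => (e z)ᴴ) x * covD (torusT P i) U μ v x)
        = ∑ x : Site P i, ∑ μ : Fin P.d, (((covD (torusT P i) U μ e x)ᴴ * covD (torusT P i) U μ v x).trace).re :=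
      Finset.sum_congr rfl fun x _ => Finset.sum_congr rfl fun μ _ => by rw [← conjTranspose_covD hU, hτa]
    rw [← hl, h, Finset.sum_congr rfl fun x _ => hτa _]
    exact (sum_re_trace_covLaplace_comm hU e v).symm
  have hEN : ∑ x : Site P i, (((divB (torusT P i) U (fun μ => covD (torusT P i) U μ e) x)ᴴ * v x).trace).re
      ≤ Real.sqrt E2 * Real.sqrt N2 := by
    -- `⟨Δe, ω²e⟩ = ⟨ωΔe, ωe⟩`
    have e1 : ∑ x : Site P i, (((divB (torusT P i) U (fun μ => covD (torusT P i) U μ e) x)ᴴ * v x).trace).re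
        = ∑ x : Site P i, ((((ω x) • divB (torusT P i) U (fun μ => covD (torusT P i) U μ e) x)ᴴ * ((ω x) • e x)).trace).re := by
      refine Finset.sum_congr rfl fun x _ => ?_
      rw [hv, re_trace_conjTranspose_mul_smul, re_trace_smul_smul, sq]
    rw [e1]
    refine (sum_re_trace_le_sqrt_mul_sqrt Finset.univ _ _).trans (le_of_eq ?_)
    rw [hE2, hN2]
    congr 1
    · congr 1; exact Finset.sum_congr rfl fun x _ => hs_smul _ _
    · congr 1; exact Finset.sum_congr rfl fun x _ => hs_smul _ _
  -- STEP 3: the remainder `≤ γ·√G2·√N2`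
  have hrem : -(∑ x : Site P i, ∑ μ : Fin P.d, (((covD (torusT P i) U μ e x)ᴴ
          * ((ω (torusT P i μ x) ^ 2 - ω x ^ 2) • R (U μ x) (e (torusT P i μ x)))).trace).re)
      ≤ (15 / 4 * a * Real.sqrt P.d) * (Real.sqrt G2 * Real.sqrt N2) := by
    -- pointwise: `|⟨D_μe, (ω₊²−ω²)R e₊⟩| ≤ (15/4)a·(ω√hs(D_μe))·(ω₊√hs(e₊))`
    have hpt : ∀ x μ, |(((covD (torusT P i) U μ e x)ᴴ * ((ω (torusT P i μ x) ^ 2 - ω x ^ 2) • R (U μ x) (e (torusT P i μ x)))).trace).re|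
        ≤ 15 / 4 * a * ((ω x * Real.sqrt (∑ j : Fin N, ∑ k : Fin N, ‖(covD (torusT P i) U μ e x) j k‖ ^ 2))
          * (ω (torusT P i μ x) * Real.sqrt (∑ j : Fin N, ∑ k : Fin N, ‖(e (torusT P i μ x)) j k‖ ^ 2))) := by
      intro x μ
      simp only [torusT_apply]
      rw [re_trace_conjTranspose_mul_smul, abs_mul]
      have hcs := abs_re_trace_le_sqrt_mul_sqrt (covD (torusT P i) U μ e x) (R (U μ x) (e (x.shift μ)))
      rw [sum_norm_sq_R (hU μ x)] at hcs
      have hrow := (sq_weight_rows ω ha0 ha hω₀ hω₁ hω₂ x μ).1.1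
      have hωx := hω₀ x
      have hst : ω x ≤ 3 / 2 * ω (x.shift μ) := by
        have h := weight_unshift_le ω ha hω₀ hω₁ (x.shift μ) μ
        rwa [unshift_shift] at h
      -- `|ω₊² − ω²| ≤ (5/2) a ω²`
      have hdiff : |ω (x.shift μ) ^ 2 - ω x ^ 2| ≤ 5 / 2 * a * ω x * ω x := by
        have h := mul_le_mul_of_nonneg_left hrow hωx.le
        rw [← mul_assoc, mul_inv_cancel₀ hωx.ne', one_mul] at h
        exact h.trans_eq (by ring)
      have hA0 : 0 ≤ Real.sqrt (∑ j : Fin N, ∑ k : Fin N, ‖(covD (torusT P i) U μ e x) j k‖ ^ 2) := Real.sqrt_nonneg _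
      have hB0 : 0 ≤ Real.sqrt (∑ j : Fin N, ∑ k : Fin N, ‖(e (x.shift μ)) j k‖ ^ 2) := Real.sqrt_nonneg _
      calc |ω (x.shift μ) ^ 2 - ω x ^ 2| * |(((covD (torusT P i) U μ e x)ᴴ * R (U μ x) (e (x.shift μ))).trace).re|
          ≤ (5 / 2 * a * ω x * ω x) * (Real.sqrt (∑ j : Fin N, ∑ k : Fin N, ‖(covD (torusT P i) U μ e x) j k‖ ^ 2)
              * Real.sqrt (∑ j : Fin N, ∑ k : Fin N, ‖(e (x.shift μ)) j k‖ ^ 2)) :=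
            mul_le_mul hdiff hcs (abs_nonneg _) (by positivity)
        _ ≤ (5 / 2 * a * ω x * (3 / 2 * ω (x.shift μ))) * (Real.sqrt (∑ j : Fin N, ∑ k : Fin N, ‖(covD (torusT P i) U μ e x) j k‖ ^ 2)
              * Real.sqrt (∑ j : Fin N, ∑ k : Fin N, ‖(e (x.shift μ)) j k‖ ^ 2)) := by gcongr
        _ = _ := by ring
    -- sum and Cauchy–Schwarz over `(x, μ)`
    have hsum : -(∑ x : Site P i, ∑ μ : Fin P.d, (((covD (torusT P i) U μ e x)ᴴ
          * ((ω (torusT P i μ x) ^ 2 - ω x ^ 2) • R (U μ x) (e (torusT P i μ x)))).trace).re)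
        ≤ 15 / 4 * a * ∑ x : Site P i, ∑ μ : Fin P.d, (ω x * Real.sqrt (∑ j : Fin N, ∑ k : Fin N, ‖(covD (torusT P i) U μ e x) j k‖ ^ 2))
          * (ω (torusT P i μ x) * Real.sqrt (∑ j : Fin N, ∑ k : Fin N, ‖(e (torusT P i μ x)) j k‖ ^ 2)) := by
      rw [Finset.mul_sum, ← Finset.sum_neg_distrib]
      refine Finset.sum_le_sum fun x _ => ?_
      rw [Finset.mul_sum, ← Finset.sum_neg_distrib]
      refine Finset.sum_le_sum fun μ _ => ?_
      exact (neg_le_abs _).trans (hpt x μ)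
    have hCS : ∑ x : Site P i, ∑ μ : Fin P.d, (ω x * Real.sqrt (∑ j : Fin N, ∑ k : Fin N, ‖(covD (torusT P i) U μ e x) j k‖ ^ 2))
          * (ω (torusT P i μ x) * Real.sqrt (∑ j : Fin N, ∑ k : Fin N, ‖(e (torusT P i μ x)) j k‖ ^ 2))
        ≤ Real.sqrt G2 * Real.sqrt ((P.d : ℝ) * N2) := by
      have h := Real.sum_mul_le_sqrt_mul_sqrt (Finset.univ : Finset (Site P i × Fin P.d))
        (fun p => ω p.1 * Real.sqrt (∑ j : Fin N, ∑ k : Fin N, ‖(covD (torusT P i) U p.2 e p.1) j k‖ ^ 2))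
        (fun p => ω (torusT P i p.2 p.1) * Real.sqrt (∑ j : Fin N, ∑ k : Fin N, ‖(e (torusT P i p.2 p.1)) j k‖ ^ 2))
      simp only [Fintype.sum_prod_type] at h
      refine h.trans (le_of_eq ?_)
      have eG : ∑ x : Site P i, ∑ μ : Fin P.d, (ω x * Real.sqrt (∑ j : Fin N, ∑ k : Fin N, ‖(covD (torusT P i) U μ e x) j k‖ ^ 2)) ^ 2 = G2 := by
        rw [hG2]
        refine Finset.sum_congr rfl fun x _ => Finset.sum_congr rfl fun μ _ => ?_
        rw [mul_pow, Real.sq_sqrt (Finset.sum_nonneg fun _ _ => Finset.sum_nonneg fun _ _ => sq_nonneg _)]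
      have eN : ∑ x : Site P i, ∑ μ : Fin P.d, (ω (torusT P i μ x) * Real.sqrt (∑ j : Fin N, ∑ k : Fin N, ‖(e (torusT P i μ x)) j k‖ ^ 2)) ^ 2
          = (P.d : ℝ) * N2 := by
        have e2 : ∑ x : Site P i, ∑ μ : Fin P.d, (ω (torusT P i μ x) * Real.sqrt (∑ j : Fin N, ∑ k : Fin N, ‖(e (torusT P i μ x)) j k‖ ^ 2)) ^ 2
            = ∑ x : Site P i, ∑ μ : Fin P.d, ω (x.shift μ) ^ 2 * ∑ j : Fin N, ∑ k : Fin N, ‖(e (x.shift μ)) j k‖ ^ 2 :=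
          Finset.sum_congr rfl fun x _ => Finset.sum_congr rfl fun μ _ => by
            rw [torusT_apply, mul_pow, Real.sq_sqrt (Finset.sum_nonneg fun _ _ => Finset.sum_nonneg fun _ _ => sq_nonneg _)]
        rw [e2, Finset.sum_comm, hN2]
        rw [show (∑ μ : Fin P.d, ∑ x : Site P i, ω (x.shift μ) ^ 2 * ∑ j : Fin N, ∑ k : Fin N, ‖(e (x.shift μ)) j k‖ ^ 2)
            = ∑ _μ : Fin P.d, ∑ x : Site P i, ω x ^ 2 * ∑ j : Fin N, ∑ k : Fin N, ‖(e x) j k‖ ^ 2 from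
            Finset.sum_congr rfl fun μ _ => sum_shift μ (fun x => ω x ^ 2 * ∑ j : Fin N, ∑ k : Fin N, ‖(e x) j k‖ ^ 2),
          Finset.sum_const, Finset.card_univ, Fintype.card_fin, nsmul_eq_mul]
      rw [eG, eN]
    have hsq : Real.sqrt ((P.d : ℝ) * N2) = Real.sqrt P.d * Real.sqrt N2 := Real.sqrt_mul hd N2
    calc _ ≤ _ := hsum
      _ ≤ 15 / 4 * a * (Real.sqrt G2 * Real.sqrt ((P.d : ℝ) * N2)) := mul_le_mul_of_nonneg_left hCS (by positivity)
      _ = (15 / 4 * a * Real.sqrt P.d) * (Real.sqrt G2 * Real.sqrt N2) := by rw [hsq]; ring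
  -- COMBINE: `G2 ≤ √E2√N2 + γ√G2√N2` ⇒ `G2 ≤ 2√N2√E2 + γ²N2`
  have hG : G2 ≤ Real.sqrt E2 * Real.sqrt N2 + (15 / 4 * a * Real.sqrt P.d) * (Real.sqrt G2 * Real.sqrt N2) := by
    linarith [hEN, hrem, hstep1, hgreen]
  have hGG : Real.sqrt G2 * Real.sqrt G2 = G2 := Real.mul_self_sqrt hG0
  have hNN : Real.sqrt N2 * Real.sqrt N2 = N2 := Real.mul_self_sqrt hN0
  nlinarith [hG, hGG, hNN, Real.sqrt_nonneg G2, Real.sqrt_nonneg N2, Real.sqrt_nonneg E2,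
    sq_nonneg (Real.sqrt G2 - (15 / 4 * a * Real.sqrt P.d) * Real.sqrt N2), mul_nonneg (Real.sqrt_nonneg E2) (Real.sqrt_nonneg N2)]

end Interp

/-! ## §3 Letters for the Agmon core: Minkowski, two-sided Cauchy–Schwarz, the squared-weight transport remainder -/

section CoreLetters

variable {U : Fin P.d → Site P i → (Matrix (Fin N) (Fin N) ℂ)ˣ}

omit U in
/-- `|Σ_x Re Tr(A_xᴴB_x)| ≤ √(Σhs A)·√(Σhs B)`. [folklore] -/
theorem abs_sum_re_trace_le_sqrt_mul_sqrt {ι : Type*} (s : Finset ι) (A B : ι → Matrix (Fin N) (Fin N) ℂ) :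
    |∑ x ∈ s, (((A x)ᴴ * B x).trace).re|
      ≤ Real.sqrt (∑ x ∈ s, ∑ j : Fin N, ∑ k : Fin N, ‖(A x) j k‖ ^ 2) * Real.sqrt (∑ x ∈ s, ∑ j : Fin N, ∑ k : Fin N, ‖(B x) j k‖ ^ 2) := by
  refine abs_le.2 ⟨?_, sum_re_trace_le_sqrt_mul_sqrt s A B⟩
  have h := sum_re_trace_le_sqrt_mul_sqrt s (fun x => -A x) B
  have e1 : ∑ x ∈ s, (((-A x)ᴴ * B x).trace).re = -∑ x ∈ s, (((A x)ᴴ * B x).trace).re := by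
    rw [← Finset.sum_neg_distrib]
    exact Finset.sum_congr rfl fun x _ => by rw [Matrix.conjTranspose_neg, neg_mul, Matrix.trace_neg, Complex.neg_re]
  have e2 : ∑ x ∈ s, ∑ j : Fin N, ∑ k : Fin N, ‖(-A x) j k‖ ^ 2 = ∑ x ∈ s, ∑ j : Fin N, ∑ k : Fin N, ‖(A x) j k‖ ^ 2 :=
    Finset.sum_congr rfl fun x _ => by simp only [Matrix.neg_apply, norm_neg]
  rw [e1, e2] at h
  linarith

omit U in
/-- `hs(X + Y) = hs X + hs Y + 2·Re Tr(XᴴY)`. [folklore] -/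
theorem hs_add_eq (X Y : Matrix (Fin N) (Fin N) ℂ) :
    ∑ j : Fin N, ∑ k : Fin N, ‖(X + Y) j k‖ ^ 2
      = ∑ j : Fin N, ∑ k : Fin N, ‖X j k‖ ^ 2 + ∑ j : Fin N, ∑ k : Fin N, ‖Y j k‖ ^ 2 + 2 * ((Xᴴ * Y).trace).re := by
  rw [← re_trace_conjTranspose_mul_self, ← re_trace_conjTranspose_mul_self, ← re_trace_conjTranspose_mul_self, Matrix.conjTranspose_add,
    add_mul, mul_add, mul_add, Matrix.trace_add, Matrix.trace_add, Matrix.trace_add, Complex.add_re, Complex.add_re, Complex.add_re,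
    Summit.QuantumFields.YangMills.Theorems.Prop7CovariantCoercivity.re_trace_conjTranspose_mul_comm Y X]
  ring

omit U in
/-- **MINKOWSKI FOR THE HS-`ℓ²` NORM OF SITE FAMILIES**: `√Σ_x hs(A_x + B_x) ≤ √Σhs A + √Σhs B`. [folklore] -/
theorem sqrt_sum_hs_add_le {ι : Type*} (s : Finset ι) (A B : ι → Matrix (Fin N) (Fin N) ℂ) :
    Real.sqrt (∑ x ∈ s, ∑ j : Fin N, ∑ k : Fin N, ‖(A x + B x) j k‖ ^ 2)
      ≤ Real.sqrt (∑ x ∈ s, ∑ j : Fin N, ∑ k : Fin N, ‖(A x) j k‖ ^ 2) + Real.sqrt (∑ x ∈ s, ∑ j : Fin N, ∑ k : Fin N, ‖(B x) j k‖ ^ 2) := by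
  set SA := ∑ x ∈ s, ∑ j : Fin N, ∑ k : Fin N, ‖(A x) j k‖ ^ 2 with hSA
  set SB := ∑ x ∈ s, ∑ j : Fin N, ∑ k : Fin N, ‖(B x) j k‖ ^ 2 with hSB
  have hA0 : 0 ≤ SA := Finset.sum_nonneg fun _ _ => Finset.sum_nonneg fun _ _ => Finset.sum_nonneg fun _ _ => sq_nonneg _
  have hB0 : 0 ≤ SB := Finset.sum_nonneg fun _ _ => Finset.sum_nonneg fun _ _ => Finset.sum_nonneg fun _ _ => sq_nonneg _
  have hsum : ∑ x ∈ s, ∑ j : Fin N, ∑ k : Fin N, ‖(A x + B x) j k‖ ^ 2 = SA + SB + 2 * ∑ x ∈ s, (((A x)ᴴ * B x).trace).re := by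
    rw [hSA, hSB, Finset.mul_sum, ← Finset.sum_add_distrib, ← Finset.sum_add_distrib]
    exact Finset.sum_congr rfl fun x _ => by rw [hs_add_eq]
  have hcs := sum_re_trace_le_sqrt_mul_sqrt s A B
  rw [← hSA, ← hSB] at hcs
  rw [hsum, Real.sqrt_le_left (by positivity)]
  nlinarith [Real.sq_sqrt hA0, Real.sq_sqrt hB0, Real.sqrt_nonneg SA, Real.sqrt_nonneg SB]

/-- ★ **THE SQUARED-WEIGHT TRANSPORT REMAINDER** (the bond term of STEP EL in the core): with the weight rows (`a ≤ 1∕2`),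
`Σ_xΣ_μ hs(((ω x)⁻¹(ω(x+e_μ)² − ω(x)²))•R(U_μ x)e(x+e_μ)) ≤ ((15∕4)a√d)²·Σ_x ω²hs(e)` (unitary `U`). [cite: Balaban1984PropagatorsII, (1.9) p.226] -/
theorem sum_hs_sqweight_transport_le (hU : ∀ ν x, (U ν x : Matrix (Fin N) (Fin N) ℂ) ∈ unitary (Matrix (Fin N) (Fin N) ℂ))
    (ω : Site P i → ℝ) (e : Site P i → Matrix (Fin N) (Fin N) ℂ) {a b : ℝ} (ha0 : 0 ≤ a) (ha : a ≤ 1 / 2) (hω₀ : ∀ x, 0 < ω x)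
    (hω₁ : ∀ x μ, |ω (x.shift μ) - ω x| ≤ a * ω x ∧ |ω (x.unshift μ) - ω x| ≤ a * ω x)
    (hω₂ : ∀ x μ, |ω (x.shift μ) + ω (x.unshift μ) - 2 * ω x| ≤ b * ω x) :
    ∑ x : Site P i, ∑ μ : Fin P.d, ∑ j : Fin N, ∑ k : Fin N,
        ‖(((ω x)⁻¹ * (ω (torusT P i μ x) ^ 2 - ω x ^ 2)) • R (U μ x) (e (torusT P i μ x))) j k‖ ^ 2
      ≤ (15 / 4 * a * Real.sqrt P.d) ^ 2 * ∑ x : Site P i, ω x ^ 2 * ∑ j : Fin N, ∑ k : Fin N, ‖(e x) j k‖ ^ 2 := by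
  have hd : (0 : ℝ) ≤ P.d := Nat.cast_nonneg _
  -- pointwise
  have hpt : ∀ x μ, ∑ j : Fin N, ∑ k : Fin N, ‖(((ω x)⁻¹ * (ω (torusT P i μ x) ^ 2 - ω x ^ 2)) • R (U μ x) (e (torusT P i μ x))) j k‖ ^ 2
      ≤ (15 / 4 * a) ^ 2 * (ω (x.shift μ) ^ 2 * ∑ j : Fin N, ∑ k : Fin N, ‖(e (x.shift μ)) j k‖ ^ 2) := by
    intro x μ
    simp only [torusT_apply]
    rw [hs_smul, sum_norm_sq_R (hU μ x)]
    have hrow := (sq_weight_rows ω ha0 ha hω₀ hω₁ hω₂ x μ).1.1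
    have hωx := hω₀ x
    have hst : ω x ≤ 3 / 2 * ω (x.shift μ) := by
      have h := weight_unshift_le ω ha hω₀ hω₁ (x.shift μ) μ
      rwa [unshift_shift] at h
    have h1 : |(ω x)⁻¹ * (ω (x.shift μ) ^ 2 - ω x ^ 2)| ≤ 15 / 4 * a * ω (x.shift μ) := by
      rw [abs_mul, abs_of_pos (inv_pos.2 hωx)]
      calc (ω x)⁻¹ * |ω (x.shift μ) ^ 2 - ω x ^ 2| ≤ 5 / 2 * a * ω x := hrow
        _ ≤ 5 / 2 * a * (3 / 2 * ω (x.shift μ)) := by gcongr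
        _ = 15 / 4 * a * ω (x.shift μ) := by ring
    have h2 := pow_le_pow_left₀ (abs_nonneg _) h1 2
    rw [sq_abs] at h2
    have h0 : 0 ≤ ∑ j : Fin N, ∑ k : Fin N, ‖(e (x.shift μ)) j k‖ ^ 2 := Finset.sum_nonneg fun _ _ => Finset.sum_nonneg fun _ _ => sq_nonneg _
    calc _ ≤ (15 / 4 * a * ω (x.shift μ)) ^ 2 * ∑ j : Fin N, ∑ k : Fin N, ‖(e (x.shift μ)) j k‖ ^ 2 := mul_le_mul_of_nonneg_right h2 h0
      _ = _ := by ring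
  calc _ ≤ ∑ x : Site P i, ∑ μ : Fin P.d, (15 / 4 * a) ^ 2 * (ω (x.shift μ) ^ 2 * ∑ j : Fin N, ∑ k : Fin N, ‖(e (x.shift μ)) j k‖ ^ 2) :=
        Finset.sum_le_sum fun x _ => Finset.sum_le_sum fun μ _ => hpt x μ
    _ = (15 / 4 * a) ^ 2 * ((P.d : ℝ) * ∑ x : Site P i, ω x ^ 2 * ∑ j : Fin N, ∑ k : Fin N, ‖(e x) j k‖ ^ 2) := by
        rw [Finset.sum_comm]
        simp only [← Finset.mul_sum]
        congr 1
        rw [show (∑ μ : Fin P.d, ∑ x : Site P i, ω (x.shift μ) ^ 2 * ∑ j : Fin N, ∑ k : Fin N, ‖(e (x.shift μ)) j k‖ ^ 2)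
            = ∑ _μ : Fin P.d, ∑ x : Site P i, ω x ^ 2 * ∑ j : Fin N, ∑ k : Fin N, ‖(e x) j k‖ ^ 2 from
            Finset.sum_congr rfl fun μ _ => sum_shift μ (fun x => ω x ^ 2 * ∑ j : Fin N, ∑ k : Fin N, ‖(e x) j k‖ ^ 2),
          Finset.sum_const, Finset.card_univ, Fintype.card_fin, nsmul_eq_mul]
    _ = _ := by rw [mul_pow, mul_pow, mul_pow, Real.sq_sqrt hd]; ring

end CoreLetters

end Summit.QuantumFields.YangMills.Theorems.Prop7CovAgmonInterp

end
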